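import Mathlib
import Literature.NumberTheory.LFunctions.SuzukiWeilHilbertSpaceDefs
import Literature.NumberTheory.LFunctions.WeilZeroSum
import Literature.NumberTheory.LFunctions.ZetaPartialSumAtZeros
import HarnessLib

/-!
# Suzuki's `V(0)`: the relational evaluation `HasHatValue` is single-valued and agrees with `ψ̂`

LINE 1 — LABEL: RH-FREE (sanity theorems about the evaluation predicate of
`Literature/NumberTheory/LFunctions/SuzukiWeilHilbertSpaceDefs.lean`; no statement about RH).
Two faithfulness checks for the junk-free three-clause evaluation `HasHatValue ψ γ c` used to type
conditions (1)/(2) of M. Suzuki, *On the Hilbert space derived from the Weil distribution*, Canad. J.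
Math. (2025) = arXiv:2301.00421, Thm. 1.3:

* `HasHatValue.unique` — each `γ` carries AT MOST ONE value `c` (the clauses are exclusive by the sign
  of `Im γ`; the boundary clause is a limit in a Hausdorff space along the proper filter `𝓝[>] 0`);
* `hasHatValue_ofReal_of_integrableOn` — at a REAL point `γ`, if `ψ ∈ L²(ℝ)` is moreover integrable
  on `(0,∞)`, the value is the honest printed integral `∫₀^∞ ψ(x) e^{iγx} dx` (dominated convergence:
  `|ψ(x)e^{i(γ+iy)x}| ≤ |ψ(x)|` for `x, y > 0`). So the relational evaluation extends, and never
  contradicts, Suzuki's `ψ̂(γ) = ∫ ψ(x)e^{iγx}dx` (p. 2) wherever the latter converges absolutely.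

WHAT THIS IS NOT: nothing here bears on the truth of RH.
-/

noncomputable section

open MeasureTheory Complex Filter Set
open scoped ComplexConjugate Topology

namespace Literature.NumberTheory.LFunctions

/-- **Single-valuedness of the evaluation**: `HasHatValue ψ γ c → HasHatValue ψ γ c' → c = c'`.
[cite: Suzuki2025WeilHilbertSpace, p. 2 ("f̂(z) = (𝖥f)(z) := ∫ f(x)e^{izx}dx")] -/
theorem HasHatValue.unique {ψ : Lp ℂ 2 (volume : Measure ℝ)} {γ c c' : ℂ}
    (h : HasHatValue ψ γ c) (h' : HasHatValue ψ γ c') : c = c' := by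
  rcases h with ⟨hγ, rfl⟩ | ⟨hγ, rfl⟩ | ⟨hγ, h⟩
  · rcases h' with ⟨-, rfl⟩ | ⟨hγ', -⟩ | ⟨hγ', -⟩
    · rfl
    · exact absurd hγ (not_lt.mpr hγ'.le)
    · exact absurd hγ' (ne_of_gt hγ)
  · rcases h' with ⟨hγ', -⟩ | ⟨-, rfl⟩ | ⟨hγ', -⟩
    · exact absurd hγ (not_lt.mpr hγ'.le)
    · rfl
    · exact absurd hγ' (ne_of_lt hγ)
  · rcases h' with ⟨hγ', -⟩ | ⟨hγ', -⟩ | ⟨-, h'⟩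
    · exact absurd hγ (ne_of_gt hγ')
    · exact absurd hγ (ne_of_lt hγ')
    · exact tendsto_nhds_unique h h'

/-- **Agreement with the printed transform at real points, for integrable `ψ`**: if `ψ ∈ L²(ℝ)` is
integrable on `(0,∞)` and `γ` is real, then `HasHatValue ψ γ (∫₀^∞ ψ(x)e^{iγx}dx)` — the boundary
limit `y ↓ 0` of `∫₀^∞ ψ(x)e^{i(γ+iy)x}dx` is the absolutely convergent integral (dominated
convergence with the bound `|ψ|`). [cite: Suzuki2025WeilHilbertSpace, p. 2 ("f̂(z) = (𝖥f)(z) := ∫ f(x)e^{izx}dx")] -/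
theorem hasHatValue_ofReal_of_integrableOn (ψ : Lp ℂ 2 (volume : Measure ℝ)) {γ : ℂ} (hγ : γ.im = 0)
    (hint : IntegrableOn (fun x : ℝ ↦ (ψ : ℝ → ℂ) x) (Set.Ioi 0)) :
    HasHatValue ψ γ (upperHalfHat ψ γ) := by
  refine Or.inr (Or.inr ⟨hγ, ?_⟩)
  unfold upperHalfHat
  -- dominated convergence on `(0,∞)` with bound `‖ψ x‖`, along the filter `𝓝[>] 0`
  refine tendsto_integral_filter_of_dominated_convergence (fun x ↦ ‖(ψ : ℝ → ℂ) x‖) ?_ ?_ hint.norm ?_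
  · -- measurability of the integrands, eventually in `y`
    refine Eventually.of_forall fun y ↦ ?_
    exact (hint.aestronglyMeasurable.mul
      ((Complex.continuous_exp.comp (by fun_prop : Continuous fun x : ℝ ↦ I * (γ + I * y) * x))
        |>.aestronglyMeasurable))
  · -- the bound `‖ψ x · e^{i(γ+iy)x}‖ ≤ ‖ψ x‖` for `x > 0`, `y > 0`
    filter_upwards [self_mem_nhdsWithin] with y hy
    refine (ae_restrict_iff' measurableSet_Ioi).2 (Eventually.of_forall fun x hx ↦ ?_)
    rw [norm_mul, Complex.norm_exp]
    have hre : (I * (γ + I * (y : ℂ)) * (x : ℂ)).re = -(γ.im + y) * x := by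
      simp [Complex.mul_re, Complex.mul_im, Complex.I_re, Complex.I_im]; try ring
    rw [hre, hγ]
    have : Real.exp (-(0 + y) * x) ≤ 1 := by
      rw [Real.exp_le_one_iff]
      have hx' : (0 : ℝ) ≤ x := le_of_lt hx
      have hy' : (0 : ℝ) ≤ y := le_of_lt hy
      nlinarith
    exact mul_le_of_le_one_right (norm_nonneg _) this
  · -- pointwise convergence of the integrands as `y ↓ 0`
    refine Eventually.of_forall fun x ↦ ?_
    have hcont : Continuous fun y : ℝ ↦ (ψ : ℝ → ℂ) x * cexp (I * (γ + I * y) * x) := by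
      fun_prop
    have h0 := (hcont.tendsto 0).mono_left (nhdsWithin_le_nhds (s := Set.Ioi (0 : ℝ)))
    simpa using h0

end Literature.NumberTheory.LFunctions

namespace Literature.NumberTheory.LFunctions

/-! ## Concordance with the version of record (CJM 2025 Prop. 5.8, eq. (1.2)): the reindexing `γ ↦ −γ`

M. Suzuki, *On the Hilbert space derived from the Weil distribution*, Canad. J. Math. (2025),
doi:10.4153/S0008414X25101739 (= arXiv:2301.00421v3) is the VERSION OF RECORD of [Su25c]; the
definitions module `SuzukiWeilHilbertSpaceDefs.lean` was typed from the held arXiv v1/v2 text and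
carries its numbering ("Thm. 1.3", "Thm. 3.1"). CONCORDANCE (cell rh-crit/dbl, referee notes N1/N2,
dbl/AUDIT-LEDGER.tsv row 19; lit-2 §0): CJM Prop. 5.8 = arXiv v1 Thm. 1.3 VERBATIM except that CJM
writes the evaluations at `−γ`: `W(ψ) = Σ_γ m_γ ψ̂(−γ)`, `⟨ψ₁,ψ₂⟩_W = Σ_γ m_γ ψ̂₁(−γ)(ψ̂₂)♯(−γ)`
(CJM eq. (1.2)), condition (2) as "`ψ̂(−γ) = 1`, `|ψ̂(−γ′)| ≤ ε|γ − γ′|^{−1−δ}`". Since `Γ = −Γ` with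
`m_{−γ} = m_γ` (CJM p. 17: "the symmetry `γ ↦ −γ` of `Γ` with `m_γ = m_{−γ}`"; in the tree: the
functional equation `ρ ↦ 1 − ρ` (`ZetaZeros.riemannZetaNontrivialZeros.one_sub_mem`), `γ(1 − ρ) = −γ(ρ)`,
`riemannZetaZeroOrder_one_sub_holds` — RH-FREE),
the two shapes are EQUIVALENT; the theorems below prove this in the kernel for both conditions, for
any `V ⊆ L²(ℝ)`. The "Thm. 3.1" (`∃` a subspace `V`) cited in the Defs module is arXiv v1/v2 ONLY —
it is commented out (withdrawn) in CJM; the parametrisation of the conditions by `V` is harmless.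
SUPPORT QUALIFIER (referee N8): `upperHalfHat`/`HasHatValue` integrate over `(0,∞)`; they extend —
and never contradict — the printed full-line `ψ̂(z) = ∫ ψ(x)e^{izx}dx` for `ψ` supported in `[0,∞)`
(the only use site: `V(0) ⊆ L²(0,∞)`), not for general `ψ ∈ L²(ℝ)`. bears_on (referee N7): B-C/B-P
(LADDER-RH §1 COLUMN 6 DBR). LABEL: RH-FREE; nothing here bears on the truth of RH.
-/

/-- `γ(1 − ρ) = −γ(ρ)`: the functional-equation reflection `ρ ↦ 1 − ρ` of the zeros is `γ ↦ −γ` on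
Suzuki's parameter (CJM: "the symmetry `γ ↦ −γ` of `Γ`").
[cite: Suzuki2025WeilHilbertSpace, CJM 2025 Prop. 5.8 (= arXiv v1 Thm. 1.3), doi:10.4153/S0008414X25101739] -/
theorem suzukiZeroParam_one_sub (ρ : ℂ) : suzukiZeroParam (1 - ρ) = -suzukiZeroParam ρ := by
  unfold suzukiZeroParam
  ring

/-- `γ(ρ̄) = −conj γ(ρ)` (so `−γ̄ = γ(ρ̄)`: CJM's `(ψ̂)♯(−γ) = conj ψ̂(−γ̄)` is the value at the
parameter of the conjugate zero). [cite: Suzuki2025WeilHilbertSpace, CJM 2025 eq. (1.2) (= arXiv v1 eq. (1.1)), doi:10.4153/S0008414X25101739] -/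
theorem suzukiZeroParam_conj (ρ : ℂ) : suzukiZeroParam (conj ρ) = -conj (suzukiZeroParam ρ) := by
  simp only [suzukiZeroParam, map_mul, Complex.conj_I, map_sub, map_div₀, map_one, map_ofNat]
  ring

/-- `m(1 − ρ) = m(ρ)` for a non-trivial zero `ρ` (`riemannZetaZeroOrder_one_sub_holds` in the open
strip): CJM's "`m_γ = m_{−γ}`". RH-FREE. [cite: Suzuki2025WeilHilbertSpace, CJM 2025 p. 17 ("the symmetry γ ↦ −γ of Γ with m_γ = m_{−γ}"), doi:10.4153/S0008414X25101739] -/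
theorem riemannZetaZeroOrder_one_sub_of_mem {ρ : ℂ} (h : ρ ∈ ZetaZeros.riemannZetaNontrivialZeros) :
    riemannZetaZeroOrder (1 - ρ) = riemannZetaZeroOrder ρ :=
  riemannZetaZeroOrder_one_sub_holds (ZetaZeros.riemannZetaNontrivialZeros.re_pos h)
    (ZetaZeros.riemannZetaNontrivialZeros.re_lt_one h)

/-- **Compatibility of a value assignment is reflection-invariant**: `c` records the values of `ψ̂`
at the points `−γ_ρ` (CJM) iff it records them at the points `γ_ρ` (arXiv v1) — the two index sets
are the same set `Γ = −Γ`. RH-FREE. [cite: Suzuki2025WeilHilbertSpace, CJM 2025 Prop. 5.8 (= arXiv v1 Thm. 1.3), doi:10.4153/S0008414X25101739] -/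
theorem forall_hasHatValue_neg_iff (ψ : Lp ℂ 2 (volume : Measure ℝ)) (c : ℂ → ℂ) :
    (∀ ρ ∈ ZetaZeros.riemannZetaNontrivialZeros,
        HasHatValue ψ (-suzukiZeroParam ρ) (c (-suzukiZeroParam ρ))) ↔
      ∀ ρ ∈ ZetaZeros.riemannZetaNontrivialZeros,
        HasHatValue ψ (suzukiZeroParam ρ) (c (suzukiZeroParam ρ)) := by
  constructor
  · intro h ρ hρ
    have h1 := h (1 - ρ) (ZetaZeros.riemannZetaNontrivialZeros.one_sub_mem hρ)
    rwa [suzukiZeroParam_one_sub, neg_neg] at h1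
  · intro h ρ hρ
    have h1 := h (1 - ρ) (ZetaZeros.riemannZetaNontrivialZeros.one_sub_mem hρ)
    rwa [suzukiZeroParam_one_sub] at h1

/-- **The Weil pairing family is reflection-invariant**: for any `c : ℂ → ℂ` and `S`, the CJM family
`ρ ↦ m(ρ)·c(−γ_ρ)·conj c(−γ̄_ρ)` (eq. (1.2): `Σ_γ m_γ ψ̂(−γ)(ψ̂)♯(−γ)`) has unconditional sum `S` iff
the arXiv-v1 family `ρ ↦ m(ρ)·c(γ_ρ)·conj c(γ̄_ρ)` does — reindex by the involution `ρ ↦ 1 − ρ` of the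
zero set (`γ ↦ −γ`, `m` invariant). RH-FREE. [cite: Suzuki2025WeilHilbertSpace, CJM 2025 eq. (1.2) (= arXiv v1 eq. (1.1)), doi:10.4153/S0008414X25101739] -/
theorem hasSum_weilFamily_neg_iff (c : ℂ → ℂ) (S : ℂ) :
    HasSum (fun ρ : ZetaZeros.riemannZetaNontrivialZeros ↦
        (riemannZetaZeroOrder (ρ : ℂ) : ℂ) * c (-suzukiZeroParam ρ) *
          conj (c (-conj (suzukiZeroParam ρ)))) S ↔
      HasSum (fun ρ : ZetaZeros.riemannZetaNontrivialZeros ↦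
        (riemannZetaZeroOrder (ρ : ℂ) : ℂ) * c (suzukiZeroParam ρ) *
          conj (c (conj (suzukiZeroParam ρ)))) S := by
  -- the involution `ρ ↦ 1 − ρ` of the zero subtype
  let e : ZetaZeros.riemannZetaNontrivialZeros ≃ ZetaZeros.riemannZetaNontrivialZeros :=
    { toFun := fun ρ ↦ ⟨1 - (ρ : ℂ), ZetaZeros.riemannZetaNontrivialZeros.one_sub_mem ρ.2⟩
      invFun := fun ρ ↦ ⟨1 - (ρ : ℂ), ZetaZeros.riemannZetaNontrivialZeros.one_sub_mem ρ.2⟩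
      left_inv := fun ρ ↦ by ext; simp
      right_inv := fun ρ ↦ by ext; simp }
  have key : (fun ρ : ZetaZeros.riemannZetaNontrivialZeros ↦
        (riemannZetaZeroOrder (ρ : ℂ) : ℂ) * c (suzukiZeroParam ρ) *
          conj (c (conj (suzukiZeroParam ρ)))) ∘ e =
      fun ρ : ZetaZeros.riemannZetaNontrivialZeros ↦
        (riemannZetaZeroOrder (ρ : ℂ) : ℂ) * c (-suzukiZeroParam ρ) *
          conj (c (-conj (suzukiZeroParam ρ))) := by
    funext ρ
    simp only [Function.comp_apply, e, Equiv.coe_fn_mk, suzukiZeroParam_one_sub, map_neg,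
      riemannZetaZeroOrder_one_sub_of_mem ρ.2]
  rw [← key]
  exact e.hasSum_iff

/-- **CJM Prop. 5.8 (1) ⟺ the typed condition (1)** on any `V ⊆ L²(ℝ)`: `WeilNormIdentityOn V`
(evaluations at `γ`, arXiv v1 Thm. 1.3 (1)) is equivalent to its CJM-printed form with evaluations
at `−γ`: for every `ψ ∈ V` and every `c` recording the values `ψ̂(−γ_ρ)`,
`Σ_ρ m(ρ) c(−γ_ρ) conj c(−γ̄_ρ) = 2‖ψ‖²` unconditionally. RH-FREE concordance.
[cite: Suzuki2025WeilHilbertSpace, CJM 2025 Prop. 5.8 (1) (= arXiv v1 Thm. 1.3 (1)), doi:10.4153/S0008414X25101739] -/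
theorem weilNormIdentityOn_iff_neg (V : Set (Lp ℂ 2 (volume : Measure ℝ))) :
    WeilNormIdentityOn V ↔
      ∀ ψ ∈ V, ∀ c : ℂ → ℂ,
        (∀ ρ ∈ ZetaZeros.riemannZetaNontrivialZeros,
            HasHatValue ψ (-suzukiZeroParam ρ) (c (-suzukiZeroParam ρ))) →
          HasSum (fun ρ : ZetaZeros.riemannZetaNontrivialZeros ↦
              (riemannZetaZeroOrder (ρ : ℂ) : ℂ) * c (-suzukiZeroParam ρ) *
                conj (c (-conj (suzukiZeroParam ρ))))
            ((2 * ‖ψ‖ ^ 2 : ℝ) : ℂ) := by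
  unfold WeilNormIdentityOn
  refine forall₂_congr fun ψ _ ↦ forall_congr' fun c ↦ ?_
  rw [forall_hasHatValue_neg_iff, hasSum_weilFamily_neg_iff]

/-- **CJM Prop. 5.8 (2) ⟺ the typed condition (2)** on any `V ⊆ L²(ℝ)`: `ZeroSeparationOn V`
(arXiv v1: `ψ̂(γ) = 1`, `|ψ̂(γ′)| ≤ ε|γ − γ′|^{−1−δ}`) is equivalent to the CJM-printed form
(`ψ̂(−γ) = 1`, `|ψ̂(−γ′)| ≤ ε|γ − γ′|^{−1−δ}`, same quantifier order "δ independent of γ, ε, ψ") —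
reindex both `γ` and `γ′` by `γ ↦ −γ`; `|(−γ) − (−γ′)| = |γ − γ′|`. RH-FREE concordance.
[cite: Suzuki2025WeilHilbertSpace, CJM 2025 Prop. 5.8 (2) (= arXiv v1 Thm. 1.3 (2)), doi:10.4153/S0008414X25101739] -/
theorem zeroSeparationOn_iff_neg (V : Set (Lp ℂ 2 (volume : Measure ℝ))) :
    ZeroSeparationOn V ↔
      ∃ δ : ℝ, 0 < δ ∧ ∀ ρ ∈ ZetaZeros.riemannZetaNontrivialZeros, ∀ ε : ℝ, 0 < ε →
        ∃ ψ ∈ V, HasHatValue ψ (-suzukiZeroParam ρ) 1 ∧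
          ∀ ρ' ∈ ZetaZeros.riemannZetaNontrivialZeros, ρ' ≠ ρ →
            ∃ c : ℂ, HasHatValue ψ (-suzukiZeroParam ρ') c ∧
              ‖c‖ ≤ ε / ‖suzukiZeroParam ρ - suzukiZeroParam ρ'‖ ^ (1 + δ) := by
  unfold ZeroSeparationOn
  refine exists_congr fun δ ↦ and_congr_right fun _ ↦ ?_
  -- reflection of the two indices `ρ ↦ 1 − ρ`, `ρ' ↦ 1 − ρ'`
  have hsub : ∀ a b : ℂ, 1 - a ≠ 1 - b ↔ a ≠ b := fun a b ↦ by
    rw [ne_eq, ne_eq, sub_right_inj]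
  have hnorm : ∀ a b : ℂ, ‖suzukiZeroParam (1 - a) - suzukiZeroParam (1 - b)‖ =
      ‖suzukiZeroParam a - suzukiZeroParam b‖ := fun a b ↦ by
    rw [suzukiZeroParam_one_sub, suzukiZeroParam_one_sub, ← norm_neg]
    congr 1; ring
  constructor
  · intro h ρ hρ ε hε
    obtain ⟨ψ, hψV, h1, h2⟩ := h (1 - ρ) (ZetaZeros.riemannZetaNontrivialZeros.one_sub_mem hρ) ε hε
    refine ⟨ψ, hψV, by rwa [suzukiZeroParam_one_sub] at h1, fun ρ' hρ' hne ↦ ?_⟩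
    obtain ⟨c, hc, hcb⟩ := h2 (1 - ρ') (ZetaZeros.riemannZetaNontrivialZeros.one_sub_mem hρ')
      ((hsub ρ' ρ).2 hne)
    refine ⟨c, by rwa [suzukiZeroParam_one_sub] at hc, ?_⟩
    rwa [hnorm] at hcb
  · intro h ρ hρ ε hε
    obtain ⟨ψ, hψV, h1, h2⟩ := h (1 - ρ) (ZetaZeros.riemannZetaNontrivialZeros.one_sub_mem hρ) ε hε
    refine ⟨ψ, hψV, by rwa [suzukiZeroParam_one_sub, neg_neg] at h1, fun ρ' hρ' hne ↦ ?_⟩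
    obtain ⟨c, hc, hcb⟩ := h2 (1 - ρ') (ZetaZeros.riemannZetaNontrivialZeros.one_sub_mem hρ')
      ((hsub ρ' ρ).2 hne)
    refine ⟨c, by rwa [suzukiZeroParam_one_sub, neg_neg] at hc, ?_⟩
    rwa [hnorm] at hcb

end Literature.NumberTheory.LFunctions
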